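import Literature.Computability.Cryptography.RegevReductionCVPLiftFinish
import Literature.Computability.Cryptography.RegevBDDToLWEIdealised
import Literature.Computability.Cryptography.RegevLWESolveKernel
import Literature.Computability.Cryptography.RegevCosApprox
import Literature.Computability.Cryptography.PeikertBDDSchedule
import Literature.Computability.Cryptography.LWEPrimePowerSolver
import Literature.Computability.Cryptography.IndepLawBridge
import Literature.Computability.Cryptography.LWEProductLaws
import Literature.Computability.Cryptography.LWERateGuessTest
import Literature.Probability.Distributions.IndepProductLawKernels
import HarnessLib

/-!
# Regev 2009, Lemmas 3.6/3.7/3.11/4.1 around a KERNEL oracle: the residual A_cvpq SPLIT along the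
# boundary LAW | MACHINE, with the law half PROVED

Topic `Computability/Cryptography` (family `pqc`), sequel of `RegevReductionCVPSplit.lean` (the named
fact `regev2009_lemma_3_11_cvpqFamily q α` = residual A_cvpq: "Lemma 3.11 run with the `W'` of Lemma
3.7 with the `LWE` solver `W` substituted, in machine form") and of `RegevReductionCVPLiftFinish.lean`
(A_lift proved; `regev_lwe_to_sivp_quantum_holds_of_cvpq_of_step : A_cvpq → A_q14 → pqc.S19 as filed`),
built on the idealised analyses `RegevBDDToLWEIdealised.lean` (Lemma 3.11, Eq. (10): `regevBDD`,
`realBlockLaw`, the integer-arithmetic form `realBlockLawInt`), `RegevLWESolveKernel.lean` (Lemma 3.7's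
grid-and-verify loop `firstAcceptedK` with a Markov-kernel oracle), `RegevCosApprox.lean` (Lemma 3.6 with
the machine's RATIONAL cosine readout and threshold) and `PeikertBDDSchedule.lean` (the numerical
schedule). O. Regev, *On lattices, learning with errors, random linear codes, and cryptography*, J. ACM
56 (2009), art. 34 (author's version arXiv:2401.03703, whose page numbers are quoted). **Lemma 3.11**
(p. 18, Main procedure of the first part): "Assume that we have access to an oracle `W` that for all
`β ≤ α`, finds `s` given a polynomial number of samples from `A_{s,Ψ_β}` (without knowing `β`). Then,
there exists an efficient algorithm that given an `n`-dimensional lattice `L`, a number `r > √2 p η_ε(L)`,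
and a polynomial number of samples from `D_{L,r}`, solves `CVP^{(p)}_{L*, αp/(√2r)}`." (proof: "We sample
a vector `v ∈ L` from `D_{L,r}`, and let `a = L⁻¹v mod p`. We then output `(a, ⟨x, v⟩/p + e mod 1)` (10)
… `s = (L*)⁻¹κ_{L*}(x) mod p`. By running this procedure a polynomial number of times and then using
`W`, we can find `s`.") **Lemma 3.7** (p. 16, Handling error `Ψ_β` for `β ≤ α`) and its proof (the grid
`Z` of noise levels, "estimate the behavior of `W`" by **Lemma 3.6** (p. 16, Verifying solutions of
`LWE`: "`z := (1/n) Σ cos(2πyᵢ)`. If `z > 0.02`, it decides that `s = s'`"), "repeat"); **Lemma 4.1**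
(p. 23, proof: the transformation `(a, b) ↦ (a, b + ⟨a, t⟩)` re-randomising the secret).

## What this file does

It cuts A_cvpq — a statement about a MACHINE (`∃ T : UniformQCircuitFamily …`) whose content is BOTH
the probability/lattice mathematics of Lemmas 3.6, 3.7, 3.11, 4.1 AND the programming of Regev's
procedure around the quantum family `W` — along the boundary LAW | MACHINE, and PROVES the law half:

* **The law, kernel oracle** (`Regev2009.regevBDDK`, `Regev2009.toReal_regevBDDK_ne_le`,
  `Regev2009.toReal_regevBDDK_ne_le_readout`): Regev's idealised `BDD → LWE` experiment of
  `RegevBDDToLWEIdealised.lean` with the deterministic oracle replaced by an arbitrary Markov kernel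
  `A : Solver (Fin n) (ℤ_q) m` (the kernel of `W`'s circuit) and the verification test of Lemma 3.6 in
  the machine's rational form (`acceptSetStat q K (cosReadout (qK)) N_V (thresholdReadout α)`): if `A`
  solves `LWE_{q,Ψ̄_α}` from `m` samples with average-case probability `≥ 2/3`, `x` is within
  `(α/√2)q/r` of `κ ∈ L*`, `r ≥ √2 q η_ε(L)`, `0 < α ≤ 1`, `4πe^{πα²} ≤ qK` and
  `exp(-N_V e^{-2πα²}/256) ≤ 1/7`, then the experiment fails to output `(B^∨)⁻¹κ mod q` with probability
  at most `(K_g+1)J(m+N_V)(δ + 6ε) + (K_g+1)J·exp(-N_V e^{-2πα²}/64) + 2^{-J}` (PROVED: Lemma 3.11's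
  statistical-distance estimate `tvDist_realBlockLaw_blockLaw_le`, Lemma 3.7's grid
  `toReal_firstAcceptedK_ne_le`, Lemma 3.6's window bounds, Lemma 4.1's shift).
* **The conditional experiment and Fubini** (`Regev2009.condExpK`, `Regev2009.iidPMF_bind_condExpK`,
  `Regev2009.iidPMF_bind_condExpK_eq_regevBDDK`): the SAME experiment conditioned on the batch of lattice
  vectors `w` — all remaining randomness is the machine's own: uniform shifts `v ∈ ℤ_qⁿ`, integer
  Gaussians `floorGaussian`, the calls to `A` — in Regev's integer arithmetic
  (`⌊(K·num(v) + e + N₀/2)/N₀⌋ mod qK` with `N₀⟨x, v⟩ = num(v) ∈ ℤ`); averaging it over an i.i.d. batch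
  `w ∼ D^{P}`, `P ≥ (K_g+1)J(m+N_V)`, gives back `regevBDDK` exactly (PROVED: product-law bookkeeping,
  `realBlockLaw_eq_realBlockLawInt`).
* **The dictionary of an instance** (`Regev2009.DigitOracle.denom/numZ/denom_mul_inner_point`,
  `secretOf_zBasis`, `answerTable_eq_table_secretOf`, `condExp`): for a nonsingular `I` and a rational
  query point `x = Σ t_j b^∨_j`, `N₀(t) = 2∏ den(t_j)` and `num(v) = Σ_j N₀t_j (B-coordinates of v)_j`
  satisfy `N₀⟨x, v⟩ = num(v)`; the secret of the manufactured samples is `(B^∨)⁻¹κ mod q` and its table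
  IS the digit table of A_cvpq whenever `‖x - κ‖ < λ₁(L*)/2`; `condExp` is `condExpK` of the instance
  with the schedule `K_g = 24m+1`, `J = n+1`, `K = 512`, `N_V = 1600000(n+1)`.
* `regev2009_lemma_3_11_cvpqMachine q α` (NAMED FACT A_cvpqM, the residual): for every uniform quantum
  family `W` (no promise) there are a uniform family `T` and a negligible `ν` such that, eventually, for
  every nonsingular `I` of dimension `n`, all `ρ, k, t`, every batch `w` of `≥ nVectors (m n) n` lattice
  vectors and every `c ∈ ℤ_qⁿ`, `Pr[T on query(I,ρ,k,encBatch(w),t) does not print table(c)] ≤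
  Pr[condExp(I, W-kernel, t, w) ≠ some c] + ν(n)`. Its content is PROGRAMMING ONLY (fixed-point
  arithmetic; coin samplers for `floorGaussian (q N₀) σ` with `σ² ∈ ℚα²` and for the uniform shift,
  within negligible statistical distance; `B`-coordinates by exact linear algebra; the rational test;
  composition of uniform families with `W`, Bennett–Bernstein–Brassard–Vazirani 1997, Thm. 4.14).
* `regev2009_lemma_3_11_cvpqFamily_of_machine : A_cvpqM → A_cvpq` — PROVED (batch polynomial
  `p_N = (24p_m+2)(X+1)(p_m+1600000(X+1))`, bound `Peikert2009.failureBound m N_V (6ε) (2⁻ⁿ) + |ν|`):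
  Regev's regime `0 < α < 1`, `2√n < αq` gives `q ≥ 2`, `|α| ≤ 1`, hence `4πe^{πα²} ≤ 512q`
  (`Peikert2009.hqK_sched`) and the verification exponents (`hNV_sched`, `exp_schedNV_le_two_inv_pow`);
  `ε ≤ e^{-π}, ε ≤ 1/2` eventually; Claim 2.13 (`decodingDist_lt_half_minNorm_dual`) puts the admissible
  point within `λ₁(L*)/2` of its dual point `κ`, so the digit table is the table of `(B^∨)⁻¹κ mod q`;
  the worst-case promise `1 - 2^{-cn}` on `W` gives average-case `≥ 2/3` eventually
  (`le_searchSuccessProb_of_forall`); then A_cvpqM pointwise in the batch, Fubini, and the law.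
* `regev_lwe_to_sivp_quantum_holds_of_machine_of_step`, `regev_lwe_to_gapSVP_quantum_holds_of_machine_of_step`:
  `pqc.S19` as filed (both forms of Theorem 1.1) from A_cvpqM and A_q14 ALONE.

After this file the tree's formalisation of Regev's Theorem 1.1 rests on exactly two named residuals,
both of them statements about PROGRAMS and not about probability or lattices: A_cvpqM (classical
programming around `W`) and A_q14 (`regev2009_lemma_3_14_stepFamily`, the quantum step, Lemma 3.14).

## Satisfiability and faithfulness of A_cvpqM

A_cvpqM is not vacuous: for instances on which `condExp` succeeds (e.g. under the promise of Theorem 3.1,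
by the law above) the tables of distinct candidates are incompatible prefixes, so `T` must reproduce the
output distribution of `condExp` up to `ν` — no trivial `T` qualifies; and it is not over-strong: every
function `condExp` mentions is explicit and rational (`cosReadout`, `thresholdReadout`, `testStat`,
integer division, `B`-coordinates), the only non-exact steps being the coin samplers, whose error is
`poly(n)·2^{-n}` uniformly in `I, ρ, t, w` because the number of samples `nVectors (m n) n` depends on
`n` alone. HONEST FRAMING: the value of this file is a THEOREM about a KNOWN reduction (the law half of
Regev's Lemmas 3.6/3.7/3.11/4.1, kernel-checked, standard axioms) and a sharper CERTIFICATE of what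
remains assumed — it is NOT progress on any summit and breaks nothing.

References: Regev2009 / RegevLWE2009 (J. ACM 56 (2009) 34; arXiv:2401.03703: Claim 2.13 p. 14, §3.2.1
pp. 15–16, Lemma 3.6 p. 16, Lemma 3.7 p. 16, Lemma 3.11 p. 18, Lemma 4.1 p. 23); Peikert2009 (STOC 2009,
Prop. 3.2: the classical use of Regev's procedure); BennettBernsteinBrassardVazirani1997 (SIAM J. Comput.
26, Thm. 4.14: subroutine composition); MicciancioRegev2007 (smoothing parameter).
-/

noncomputable section

open Finset Module MeasureTheory Filter
open scoped ENNReal Real InnerProductSpace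

namespace Literature.Computability.Cryptography

namespace Regev2009

open Literature.Probability.Distributions Literature.Probability.Moments LWE
  Literature.Algebra.EuclideanLattices

/-! ### Regev's grid with a kernel oracle (Lemma 3.7 for an arbitrary, possibly randomised, solver) -/

section KernelGrid

variable {ι : Type} [Fintype ι] [DecidableEq ι] (q K : ℕ) [NeZero q] [NeZero K] (m NV : ℕ)

/-- **The failure bound with Gaussian noise, kernel oracle.** As `toReal_firstAccepted_ne_le_gaussian`
with a Markov-kernel solver `A` of average-case success `≥ 2/3` on `LWE_{q,Ψ̄_α}` from `m` samples.
[cite: RegevLWE2009, Lemma 3.7 (proof) with Lemmas 3.6, 4.1] -/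
theorem toReal_firstAcceptedK_ne_le_gaussian {nB : ℕ} (βO : Fin nB → ℝ) (β : ℝ) {α : ℝ} (s : ι → ZMod q)
    (A : Solver ι (ZMod q) m)
    (hF : ENNReal.ofReal (2 / 3) ≤ searchSuccessProb (discretizedGaussian q α) m A)
    (Acc : (ι → ZMod q) → Set (Fin NV → (ι → ZMod q) × ZMod (q * K))) {ηA ηR : ℝ} (hηA : 0 ≤ ηA)
    (hA : ∀ c, c ≠ s → ((iidPMF (lweSampleK q K (discretizedGaussian (q * K) β) s) NV).toOuterMeasure
      (Acc c)).toReal ≤ ηA)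
    (hR : ((iidPMF (lweSampleK q K (discretizedGaussian (q * K) β) s) NV).toOuterMeasure (Acc s)ᶜ).toReal ≤ ηR)
    (hηR : ηR ≤ 1) (T : Finset (Fin nB))
    (hT : ∀ j ∈ T, (m : ℝ) * (discretizedGaussian q (βO j)).tvDist (discretizedGaussian q α) ≤ 1 / 12) :
    ((indepLaw nB fun j => blockLawK q K m NV (discretizedGaussian q (βO j))
        (discretizedGaussian (q * K) β) A s).toOuterMeasure
        {D | firstAcceptedK q K m NV Acc D ≠ some s}).toReal ≤
      nB * ηA + (1 - 7 / 12 * (1 - ηR)) ^ T.card := by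
  refine toReal_firstAcceptedK_ne_le q K m NV (fun j => discretizedGaussian q (βO j))
    (discretizedGaussian (q * K) β) A s Acc hηA hA hR hηR T fun j hj => ?_
  have h1 := two_thirds_le_toReal (searchSuccessProb_le_one_holds _ _ _) hF
  have h2 := toReal_searchSuccessProb_sub_le (discretizedGaussian q α) (discretizedGaussian q (βO j)) m A
  rw [PMF.tvDist_comm] at h2
  linarith [hT j hj]

/-- **Regev 2009, Lemma 3.7 with a kernel oracle — the failure bound on the grid**:
`Pr[output ≠ s] ≤ (K_g+1)·J·η_A + (1 - (7/12)(1 - η_R))^J`.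
[cite: RegevLWE2009, Lemma 3.7 (proof) with Lemmas 3.6, 4.1 and Claim 2.2] -/
theorem toReal_firstAcceptedK_ne_le_grid {Kg J : ℕ} (hKg : 24 * m ≤ Kg) (hKg1 : 1 ≤ Kg) {α β : ℝ}
    (hβ : 0 < β) (hβα : β ≤ α) (s : ι → ZMod q) (A : Solver ι (ZMod q) m)
    (hF : ENNReal.ofReal (2 / 3) ≤ searchSuccessProb (discretizedGaussian q α) m A)
    (Acc : (ι → ZMod q) → Set (Fin NV → (ι → ZMod q) × ZMod (q * K))) {ηA ηR : ℝ} (hηA : 0 ≤ ηA)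
    (hA : ∀ c, c ≠ s → ((iidPMF (lweSampleK q K (discretizedGaussian (q * K) β) s) NV).toOuterMeasure
      (Acc c)).toReal ≤ ηA)
    (hR : ((iidPMF (lweSampleK q K (discretizedGaussian (q * K) β) s) NV).toOuterMeasure (Acc s)ᶜ).toReal ≤ ηR)
    (hηR : ηR ≤ 1) :
    ((indepLaw ((Kg + 1) * J) fun j => blockLawK q K m NV (discretizedGaussian q (levelNoise α β Kg J j))
        (discretizedGaussian (q * K) β) A s).toOuterMeasure
        {D | firstAcceptedK q K m NV Acc D ≠ some s}).toReal ≤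
      ((Kg + 1) * J : ℕ) * ηA + (1 - 7 / 12 * (1 - ηR)) ^ J := by
  obtain ⟨k, hk, -, -, htv⟩ := exists_level_tvDist_le q hβ hβα hKg1
  have hKpos : (0 : ℝ) < Kg := Nat.cast_pos.2 hKg1
  set kF : Fin (Kg + 1) := ⟨k, Nat.lt_succ_of_le hk⟩ with hkF
  have hinj : Function.Injective fun i : Fin J => finProdFinEquiv (kF, i) := fun i i' h => by
    simpa using congrArg Prod.snd (finProdFinEquiv.injective h)
  set T : Finset (Fin ((Kg + 1) * J)) := univ.image fun i : Fin J => finProdFinEquiv (kF, i) with hTdef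
  have hcard : T.card = J := by rw [hTdef, card_image_of_injective _ hinj, card_univ, Fintype.card_fin]
  have hT : ∀ j ∈ T, (m : ℝ) * (discretizedGaussian q (levelNoise α β Kg J j)).tvDist
      (discretizedGaussian q α) ≤ 1 / 12 := by
    intro j hj
    rw [hTdef, mem_image] at hj
    obtain ⟨i, -, rfl⟩ := hj
    have hlev : levelNoise α β Kg J (finProdFinEquiv (kF, i)) = Real.sqrt (β ^ 2 + k * (α ^ 2 / Kg)) := by
      simp only [levelNoise, Equiv.symm_apply_apply]
      rfl
    rw [hlev]
    calc (m : ℝ) * (discretizedGaussian q (Real.sqrt (β ^ 2 + k * (α ^ 2 / Kg)))).tvDist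
          (discretizedGaussian q α) ≤ m * (2 / Kg) :=
          mul_le_mul_of_nonneg_left htv (Nat.cast_nonneg m)
      _ ≤ 1 / 12 := by
          rw [mul_div_assoc', div_le_div_iff₀ hKpos (by norm_num : (0:ℝ) < 12)]
          have : (24 * m : ℝ) ≤ Kg := by exact_mod_cast hKg
          linarith
  have h := toReal_firstAcceptedK_ne_le_gaussian q K m NV (levelNoise α β Kg J) β s A hF Acc hηA hA hR hηR T hT
  rwa [hcard] at h

/-- **Simplified form** (`η_R ≤ 1/7`): `Pr[output ≠ s] ≤ (K_g+1)·J·η_A + 2^{-J}`. [cite: RegevLWE2009, Lemma 3.7 (proof)] -/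
theorem toReal_firstAcceptedK_ne_le_grid_simple {Kg J : ℕ} (hKg : 24 * m ≤ Kg) (hKg1 : 1 ≤ Kg) {α β : ℝ}
    (hβ : 0 < β) (hβα : β ≤ α) (s : ι → ZMod q) (A : Solver ι (ZMod q) m)
    (hF : ENNReal.ofReal (2 / 3) ≤ searchSuccessProb (discretizedGaussian q α) m A)
    (Acc : (ι → ZMod q) → Set (Fin NV → (ι → ZMod q) × ZMod (q * K))) {ηA ηR : ℝ} (hηA : 0 ≤ ηA)
    (hA : ∀ c, c ≠ s → ((iidPMF (lweSampleK q K (discretizedGaussian (q * K) β) s) NV).toOuterMeasure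
      (Acc c)).toReal ≤ ηA)
    (hR : ((iidPMF (lweSampleK q K (discretizedGaussian (q * K) β) s) NV).toOuterMeasure (Acc s)ᶜ).toReal ≤ ηR)
    (hηR7 : ηR ≤ 1 / 7) :
    ((indepLaw ((Kg + 1) * J) fun j => blockLawK q K m NV (discretizedGaussian q (levelNoise α β Kg J j))
        (discretizedGaussian (q * K) β) A s).toOuterMeasure
        {D | firstAcceptedK q K m NV Acc D ≠ some s}).toReal ≤
      ((Kg + 1) * J : ℕ) * ηA + (1 / 2) ^ J := by
  have hR0 : 0 ≤ ((iidPMF (lweSampleK q K (discretizedGaussian (q * K) β) s) NV).toOuterMeasure (Acc s)ᶜ).toReal :=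
    ENNReal.toReal_nonneg
  refine (toReal_firstAcceptedK_ne_le_grid q K m NV hKg hKg1 hβ hβα s A hF Acc hηA hA hR (by linarith)).trans
    (add_le_add le_rfl ?_)
  have h0 : 0 ≤ 1 - 7 / 12 * (1 - ηR) := by nlinarith
  exact pow_le_pow_left₀ h0 (by linarith) J

end KernelGrid

/-! ### Inserting the kernel's answer into a block of data -/

section Answer

variable {ι : Type} [Fintype ι] [DecidableEq ι] (q K : ℕ) [NeZero q] (m NV : ℕ)

/-- LOCAL GLUE. **The oracle call of a block**: given the block's data (shift `t`, `m` coarse samples,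
`N_V` fine samples), draw the kernel's answer on the SHIFTED coarse batch and insert it.
[cite: RegevLWE2009, Lemma 3.7 (proof) with Lemma 4.1 (proof)] -/
def withAnswer (A : Solver ι (ZMod q) m)
    (d : ((ι → ZMod q) × (Fin m → (ι → ZMod q) × ZMod q)) × (Fin NV → (ι → ZMod q) × ZMod (q * K))) :
    PMF ((((ι → ZMod q) × (Fin m → (ι → ZMod q) × ZMod q)) × (ι → ZMod q)) ×
      (Fin NV → (ι → ZMod q) × ZMod (q * K))) :=
  (A (shiftSample d.1.1 ∘ d.1.2)).map fun a => ((d.1, a), d.2)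

omit [Fintype ι] [DecidableEq ι] [NeZero q] in
/-- Product of a compound law with an independent factor: draw the factor first. [folklore] -/
theorem prodLaw_bind_left {α β γ : Type*} (P : PMF α) (κ : α → PMF β) (R : PMF γ) :
    prodLaw (P.bind κ) R = (prodLaw P R).bind fun d => (κ d.1).map fun b => (b, d.2) := by
  simp only [prodLaw, PMF.bind_bind, PMF.map]
  refine congrArg P.bind (funext fun a => ?_)
  rw [PMF.bind_comm]
  simp only [Function.comp_apply, PMF.pure_bind, Function.comp_def]

/-- **The kernel block law is the ideal block law followed by the oracle call.** [folklore] -/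
theorem blockLawK_eq_bind_withAnswer (χO : PMF (ZMod q)) (χV : PMF (ZMod (q * K))) (A : Solver ι (ZMod q) m)
    (s : ι → ZMod q) :
    blockLawK q K m NV χO χV A s = (blockLaw q K m NV χO χV s).bind (withAnswer q K m NV A) := by
  unfold blockLawK queryLawK blockLaw withAnswer
  rw [prodLaw_bind_left]
  refine congrArg _ (funext fun d => ?_)
  rw [PMF.map_comp]
  rfl

end Answer

/-! ### The idealised `BDD → LWE` experiment with a kernel oracle and the secret as output -/

section ExperimentK

variable {E : Type*} [NormedAddCommGroup E] [InnerProductSpace ℝ E] [FiniteDimensional ℝ E]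
  [MeasurableSpace E] [BorelSpace E]
variable {L : Submodule ℤ E} [DiscreteTopology L] [IsZLattice ℝ L]
variable {n : ℕ} (bL : Basis (Fin n) ℤ L) (q K : ℕ) [NeZero q] [NeZero K] (m NV Kg J : ℕ)

/-- LOCAL GLUE. **The law of block `j` with the oracle's answer**: the block's data as the reduction
samples it (`realBlockLaw`), then the kernel oracle `A` called on the shifted coarse batch.
[cite: RegevLWE2009, Lemma 3.11 (proof) with Lemma 3.7 (proof) and Lemma 4.1 (proof)] -/
def realBlockLawK (D : PMF L) (x : E) (α : ℝ) (A : Solver (Fin n) (ZMod q) m) (j : Fin ((Kg + 1) * J)) :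
    PMF ((((Fin n → ZMod q) × (Fin m → (Fin n → ZMod q) × ZMod q)) × (Fin n → ZMod q)) ×
      (Fin NV → (Fin n → ZMod q) × ZMod (q * K))) :=
  (realBlockLaw bL q K m NV Kg J D x α j).bind (withAnswer q K m NV A)

/-- LOCAL GLUE. **Regev's classical `BDD → LWE` reduction with a kernel oracle, idealised, secret as
output**: `(K_g+1)·J` independent blocks (uniform shift, `m` coarse and `N_V` fine manufactured samples
from the lattice sampler `D` and the target `x`, the oracle's answer on the shifted coarse batch), then
`firstAcceptedK` (un-shift each answer, verification test `Acc` on the block's fine batch, first accepted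
candidate). [cite: RegevLWE2009, Lemma 3.4 (proof = §3.2.1: Lemmas 3.7, 3.11); Peikert2009, Prop. 3.2] -/
def regevBDDK (D : PMF L) (x : E) (α : ℝ) (A : Solver (Fin n) (ZMod q) m)
    (Acc : (Fin n → ZMod q) → Set (Fin NV → (Fin n → ZMod q) × ZMod (q * K))) :
    PMF (Option (Fin n → ZMod q)) :=
  (indepLaw ((Kg + 1) * J) (realBlockLawK bL q K m NV Kg J D x α A)).map (firstAcceptedK q K m NV Acc)

/-- **Regev 2009, Lemmas 3.7 + 3.11 with a kernel oracle — the success bound.** `0 < ε ≤ 1/2`, `0 < r`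
with `√2·q·η_ε(L) ≤ r`, `0 < α`, a lattice sampler `D` with `Δ(D, D_{L,r}) ≤ δ`, a target `x` and
`κ ∈ L*` with `r‖x - κ‖ ≤ (α/√2)·q`, a KERNEL oracle `A` solving `LWE_{q,Ψ̄_α}` from `m` samples with
average-case probability `≥ 2/3`, `K_g ≥ max(1, 24m)`, and a verification test `Acc` with error bounds
`(η_A, η_R)`, `η_R ≤ 1/7`, uniformly over fine noise `Ψ̄^{(qK)}_{β'}`, `0 < β' ≤ α`. Then
`Pr[regevBDDK ≠ some (L⁻¹κ mod q)] ≤ (K_g+1)J(m+N_V)(δ+6ε) + (K_g+1)J·η_A + 2^{-J}`.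
[cite: RegevLWE2009, Lemma 3.4 with Lemmas 3.6, 3.7, 3.11 and Lemma 4.1 (proof); Peikert2009, Prop. 3.2] -/
theorem toReal_regevBDDK_ne_le (D : PMF L) {δ ε r α : ℝ} (hD : D.tvDist (discreteGaussian L r 0) ≤ δ)
    (hε : 0 < ε) (hε' : ε ≤ 1 / 2) (hr : 0 < r) (hα : 0 < α)
    (hη : Real.sqrt 2 * q * smoothingParameter L ε ≤ r) (x : E) {κ : E} (hκ : κ ∈ dualLattice L)
    (hx : r * ‖x - κ‖ ≤ α / Real.sqrt 2 * q) (A : Solver (Fin n) (ZMod q) m)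
    (hF : ENNReal.ofReal (2 / 3) ≤ searchSuccessProb (discretizedGaussian q α) m A)
    (hKg : 24 * m ≤ Kg) (hKg1 : 1 ≤ Kg)
    (Acc : (Fin n → ZMod q) → Set (Fin NV → (Fin n → ZMod q) × ZMod (q * K))) {ηA ηR : ℝ} (hηA : 0 ≤ ηA)
    (hAcc : ∀ β' : ℝ, 0 < β' → β' ≤ α → ∀ s' : Fin n → ZMod q,
      (∀ c, c ≠ s' → ((iidPMF (lweSampleK q K (discretizedGaussian (q * K) β') s') NV).toOuterMeasure
        (Acc c)).toReal ≤ ηA) ∧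
      ((iidPMF (lweSampleK q K (discretizedGaussian (q * K) β') s') NV).toOuterMeasure (Acc s')ᶜ).toReal ≤ ηR)
    (hηR7 : ηR ≤ 1 / 7) :
    ((regevBDDK bL q K m NV Kg J D x α A Acc).toOuterMeasure {o | o ≠ some (secretOf bL q κ)}).toReal ≤
      ((Kg + 1) * J : ℕ) * ((m + NV) * (δ + 6 * ε)) + (((Kg + 1) * J : ℕ) * ηA + (1 / 2) ^ J) := by
  set s : Fin n → ZMod q := secretOf bL q κ with hs
  set β : ℝ := Real.sqrt ((r * ‖x - κ‖ / q) ^ 2 + (α / Real.sqrt 2) ^ 2) with hβ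
  have hα2 : 0 < α / Real.sqrt 2 := by positivity
  have hβpos : 0 < β := by
    refine lt_of_lt_of_le hα2 ?_
    calc α / Real.sqrt 2 = Real.sqrt ((α / Real.sqrt 2) ^ 2) := (Real.sqrt_sq hα2.le).symm
      _ ≤ β := Real.sqrt_le_sqrt (le_add_of_nonneg_left (sq_nonneg _))
  have hβα : β ≤ α := by
    have h := noiseParam_le q hα2 hx (mul_nonneg hr.le (norm_nonneg _))
    rwa [mul_div_cancel₀ _ (Real.sqrt_ne_zero'.2 two_pos)] at h
  set P := indepLaw ((Kg + 1) * J) fun j => blockLawK q K m NV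
    (discretizedGaussian q (levelNoise α β Kg J j)) (discretizedGaussian (q * K) β) A s with hP
  obtain ⟨hA, hR⟩ := hAcc β hβpos hβα s
  have hideal := toReal_firstAcceptedK_ne_le_grid_simple q K m NV (J := J) hKg hKg1 hβpos hβα s A hF Acc
    hηA hA hR hηR7
  have htv : (indepLaw ((Kg + 1) * J) (realBlockLawK bL q K m NV Kg J D x α A)).tvDist P ≤
      ((Kg + 1) * J : ℕ) * ((m + NV) * (δ + 6 * ε)) := by
    refine (tvDist_indepLaw_le _ _ _).trans ?_
    calc ∑ j, (realBlockLawK bL q K m NV Kg J D x α A j).tvDist _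
        ≤ ∑ _j : Fin ((Kg + 1) * J), (m + NV) * (δ + 6 * ε) := sum_le_sum fun j _ => by
          rw [realBlockLawK, blockLawK_eq_bind_withAnswer]
          exact (PMF.tvDist_bind_left_le _ _ _).trans
            (tvDist_realBlockLaw_blockLaw_le bL q K m NV Kg J D hD hε hε' hr hα hη hκ hx j)
      _ = ((Kg + 1) * J : ℕ) * ((m + NV) * (δ + 6 * ε)) := by
          rw [sum_const, card_univ, Fintype.card_fin, nsmul_eq_mul]
  set Aev : Set (Fin ((Kg + 1) * J) → (((Fin n → ZMod q) × (Fin m → (Fin n → ZMod q) × ZMod q)) ×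
      (Fin n → ZMod q)) × (Fin NV → (Fin n → ZMod q) × ZMod (q * K))) :=
    {data | firstAcceptedK q K m NV Acc data ≠ some s} with hAev
  rw [regevBDDK, PMF.toOuterMeasure_map_apply]
  calc ((indepLaw ((Kg + 1) * J) (realBlockLawK bL q K m NV Kg J D x α A)).toOuterMeasure _).toReal
      = ((indepLaw ((Kg + 1) * J) (realBlockLawK bL q K m NV Kg J D x α A)).toOuterMeasure Aev).toReal := rfl
    _ ≤ (P.toOuterMeasure Aev).toReal +
          (indepLaw ((Kg + 1) * J) (realBlockLawK bL q K m NV Kg J D x α A)).tvDist P := by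
        have h := PMF.abs_toReal_toOuterMeasure_sub_le_tvDist
          (indepLaw ((Kg + 1) * J) (realBlockLawK bL q K m NV Kg J D x α A)) P Aev
        rw [abs_le] at h
        linarith [h.2]
    _ ≤ (((Kg + 1) * J : ℕ) * ηA + (1 / 2) ^ J) + ((Kg + 1) * J : ℕ) * ((m + NV) * (δ + 6 * ε)) :=
        add_le_add hideal htv
    _ = _ := by ring

/-- **The instance with the machine's rational cosine test** (`RegevCosApprox.lean`: readout
`cosReadout (qK)`, threshold `thresholdReadout α`; `|α| ≤ 1`, `4πe^{πα²} ≤ qK`,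
`e^{-N_V e^{-2πα²}/256} ≤ 1/7`):
`Pr[regevBDDK ≠ some (L⁻¹κ mod q)] ≤ (K_g+1)J(m+N_V)(δ+6ε) + (K_g+1)J·e^{-N_V e^{-2πα²}/64} + 2^{-J}`.
[cite: RegevLWE2009, Lemma 3.4 with Lemmas 3.6, 3.7, 3.11 and Lemma 4.1 (proof); Peikert2009, Prop. 3.2] -/
theorem toReal_regevBDDK_ne_le_readout (D : PMF L) {δ ε r α : ℝ} (hD : D.tvDist (discreteGaussian L r 0) ≤ δ)
    (hε : 0 < ε) (hε' : ε ≤ 1 / 2) (hr : 0 < r) (hα : 0 < α) (hα1 : α ≤ 1)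
    (hη : Real.sqrt 2 * q * smoothingParameter L ε ≤ r) (x : E) {κ : E} (hκ : κ ∈ dualLattice L)
    (hx : r * ‖x - κ‖ ≤ α / Real.sqrt 2 * q) (A : Solver (Fin n) (ZMod q) m)
    (hF : ENNReal.ofReal (2 / 3) ≤ searchSuccessProb (discretizedGaussian q α) m A)
    (hKg : 24 * m ≤ Kg) (hKg1 : 1 ≤ Kg) (hqK : 4 * π * Real.exp (π * α ^ 2) ≤ (q * K : ℕ))
    (hNV : Real.exp (-(NV * Real.exp (-(2 * π * α ^ 2)) / 256)) ≤ 1 / 7) :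
    ((regevBDDK bL q K m NV Kg J D x α A
        (acceptSetStat q K (cosReadout (q * K)) NV (thresholdReadout α))).toOuterMeasure
        {o | o ≠ some (secretOf bL q κ)}).toReal ≤
      ((Kg + 1) * J : ℕ) * ((m + NV) * (δ + 6 * ε)) +
        (((Kg + 1) * J : ℕ) * Real.exp (-(NV * Real.exp (-(2 * π * α ^ 2)) / 64)) + (1 / 2) ^ J) := by
  have hαabs : |α| ≤ 1 := by rw [abs_of_pos hα]; exact hα1
  have hw := thresholdReadout_mem_window hαabs
  have hη16 := one_div_thousand_le_exp_div_sixteen hαabs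
  exact toReal_regevBDDK_ne_le bL q K m NV Kg J D hD hε hε' hr hα hη x hκ hx A hF hKg hKg1 _
    (Real.exp_pos _).le (fun β' hβ' hβ'α s' =>
      ⟨fun c hc => toReal_acceptStat_of_ne_le_window q K _ α hc NV (abs_cosReadout_sub_le (q * K))
          (abs_cosReadout_le_one (q * K)) hη16 hw.1,
       toReal_rejectStat_self_le_window q K (by rw [abs_of_pos hβ']; exact hβ'α) hqK s' NV
          (abs_cosReadout_sub_le (q * K)) (abs_cosReadout_le_one (q * K)) hη16 hw.2⟩) hNV

end ExperimentK

/-! ### The experiment conditioned on the lattice batch (what the machine simulates exactly) -/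

section Conditional

/-- Two-stage draws in both factors of a product law. [folklore] -/
theorem prodLaw_bind_prod {α β γ δ : Type*} (P : PMF α) (R : PMF γ) (X : α → PMF β) (Y : γ → PMF δ) :
    ((prodLaw P R).bind fun p => prodLaw (X p.1) (Y p.2)) = prodLaw (P.bind X) (R.bind Y) := by
  simp only [prodLaw, PMF.bind_bind, PMF.bind_map, PMF.map_bind, Function.comp_def]
  refine congrArg P.bind (funext fun a => ?_)
  rw [PMF.bind_comm]

/-- A first-stage draw in the second factor of a product law can be drawn first. [folklore] -/
theorem prodLaw_bind_right {α β τ : Type*} (U : PMF τ) (P : PMF α) (X : α → PMF β) :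
    prodLaw U (P.bind X) = P.bind fun a => prodLaw U (X a) := by
  simp only [prodLaw, PMF.map_bind]
  rw [PMF.bind_comm]

variable {E : Type} [NormedAddCommGroup E] [InnerProductSpace ℝ E]
variable {L : Submodule ℤ E} {n : ℕ} (bL : Basis (Fin n) ℤ L) (q K : ℕ) [NeZero q] [NeZero K] (m NV Kg J : ℕ)

/-- LOCAL GLUE. **The coarse manufactured sample from ONE lattice vector**, integer arithmetic form
(`RegevBDDIntegerNoise.lean`): `v ↦ (L⁻¹v mod q, ⌊(num v + i + N/2)/N⌋ mod q)`, `i ← floorGaussian (qN) (padNoise_j)`.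
[cite: RegevLWE2009, Lemma 3.11 (proof, Eq. (10)) with Lemma 3.7 (proof)] -/
def coarseKer (α : ℝ) (N : ℕ) (num : L → ℤ) (j : Fin ((Kg + 1) * J)) (v : L) : PMF ((Fin n → ZMod q) × ZMod q) :=
  (floorGaussian (q * N) (padNoise α Kg J j)).map fun i : ℤ =>
    (coeffMod bL q v, (((num v + i + (N / 2 : ℕ)) / (N : ℤ) : ℤ) : ZMod q))

/-- LOCAL GLUE. **The fine manufactured sample from ONE lattice vector** (modulus `qK`, parameter `α/√2`).
[cite: RegevLWE2009, Lemma 3.11 (proof, Eq. (10)) with Lemma 3.7 (proof: "samples from `A_{s,Ψ_β}` … to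
estimate")] -/
def fineKer (α : ℝ) (N : ℕ) (num : L → ℤ) (v : L) : PMF ((Fin n → ZMod q) × ZMod (q * K)) :=
  (floorGaussian (q * K * N) (α / Real.sqrt 2)).map fun i : ℤ =>
    (coeffMod bL q v, ((((K : ℤ) * num v + i + (N / 2 : ℕ)) / (N : ℤ) : ℤ) : ZMod (q * K)))

omit [InnerProductSpace ℝ E] [NeZero K] in
/-- `realBlockLawInt` in terms of the one-vector kernels. [folklore] -/
theorem realBlockLawInt_eq_kernels (D : PMF L) (α : ℝ) (N : ℕ) (num : L → ℤ) (j : Fin ((Kg + 1) * J)) :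
    realBlockLawInt bL q K m NV Kg J D α N num j =
      prodLaw (prodLaw (PMF.uniformOfFintype (Fin n → ZMod q)) (iidPMF (D.bind (coarseKer bL q Kg J α N num j)) m))
        (iidPMF (D.bind (fineKer bL q K α N num)) NV) := rfl

/-- LOCAL GLUE. **The data of block `j` GIVEN its `m + N_V` lattice vectors** `u`: a uniform shift, the
coarse samples made from `u₀,…,u_{m-1}` and the fine samples made from `u_m,…,u_{m+N_V-1}`, each with its
own fresh integer noise. [cite: RegevLWE2009, Lemma 3.11 (proof) with Lemma 3.7 (proof)] -/
def condBlockData (α : ℝ) (N : ℕ) (num : L → ℤ) (j : Fin ((Kg + 1) * J)) (u : Fin (m + NV) → L) :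
    PMF (((Fin n → ZMod q) × (Fin m → (Fin n → ZMod q) × ZMod q)) ×
      (Fin NV → (Fin n → ZMod q) × ZMod (q * K))) :=
  prodLaw (prodLaw (PMF.uniformOfFintype (Fin n → ZMod q))
      (indepLaw m fun i => coarseKer bL q Kg J α N num j (u (Fin.castAdd NV i))))
    (indepLaw NV fun i => fineKer bL q K α N num (u (Fin.natAdd m i)))

/-- LOCAL GLUE. **The whole experiment GIVEN the lattice batch** `w` (block `j` uses the vectors `w j`):
per block the conditional data and the oracle call, then `firstAcceptedK`. This is the law a machine with
exact samplers realises on input the batch. [cite: RegevLWE2009, Lemma 3.4 (proof = §3.2.1: Lemmas 3.7, 3.11)] -/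
def condExpK (α : ℝ) (N : ℕ) (num : L → ℤ) (A : Solver (Fin n) (ZMod q) m)
    (Acc : (Fin n → ZMod q) → Set (Fin NV → (Fin n → ZMod q) × ZMod (q * K)))
    (w : Fin ((Kg + 1) * J) → Fin (m + NV) → L) : PMF (Option (Fin n → ZMod q)) :=
  (indepLaw ((Kg + 1) * J) fun j =>
    (condBlockData bL q K m NV Kg J α N num j (w j)).bind (withAnswer q K m NV A)).map
    (firstAcceptedK q K m NV Acc)

omit [InnerProductSpace ℝ E] [NeZero K] in
/-- **Averaging the conditional block data over an iid batch gives the block law** (Fubini for the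
block). [folklore] -/
theorem iidPMF_bind_condBlockData (D : PMF L) (α : ℝ) (N : ℕ) (num : L → ℤ) (j : Fin ((Kg + 1) * J)) :
    (iidPMF D (m + NV)).bind (condBlockData bL q K m NV Kg J α N num j) =
      realBlockLawInt bL q K m NV Kg J D α N num j := by
  have hsplit : (prodLaw (iidPMF D m) (iidPMF D NV)).map ⇑(Fin.appendEquiv m NV) = iidPMF D (m + NV) := by
    rw [← iidPMF_map_appendEquiv_symm, PMF.map_comp, Equiv.self_comp_symm, PMF.map_id]
  rw [← hsplit, PMF.bind_map]
  calc (prodLaw (iidPMF D m) (iidPMF D NV)).bind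
        (condBlockData bL q K m NV Kg J α N num j ∘ ⇑(Fin.appendEquiv m NV))
      = (prodLaw (iidPMF D m) (iidPMF D NV)).bind (fun p => prodLaw
          ((fun u₁ : Fin m → L => prodLaw (PMF.uniformOfFintype (Fin n → ZMod q))
            (indepLaw m fun i => coarseKer bL q Kg J α N num j (u₁ i))) p.1)
          ((fun u₂ : Fin NV → L => indepLaw NV fun i => fineKer bL q K α N num (u₂ i)) p.2)) := by
        refine congrArg _ (funext fun p => ?_)
        simp only [Function.comp_apply, Fin.appendEquiv_apply, condBlockData, Fin.append_left,
          Fin.append_right]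
    _ = prodLaw ((iidPMF D m).bind fun u₁ => prodLaw (PMF.uniformOfFintype (Fin n → ZMod q))
            (indepLaw m fun i => coarseKer bL q Kg J α N num j (u₁ i)))
          ((iidPMF D NV).bind fun u₂ => indepLaw NV fun i => fineKer bL q K α N num (u₂ i)) :=
        prodLaw_bind_prod (iidPMF D m) (iidPMF D NV)
          (fun u₁ : Fin m → L => prodLaw (PMF.uniformOfFintype (Fin n → ZMod q))
            (indepLaw m fun i => coarseKer bL q Kg J α N num j (u₁ i)))
          (fun u₂ : Fin NV → L => indepLaw NV fun i => fineKer bL q K α N num (u₂ i))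
    _ = prodLaw (prodLaw (PMF.uniformOfFintype (Fin n → ZMod q))
            ((iidPMF D m).bind fun u₁ => indepLaw m fun i => coarseKer bL q Kg J α N num j (u₁ i)))
          ((iidPMF D NV).bind fun u₂ => indepLaw NV fun i => fineKer bL q K α N num (u₂ i)) := by
        rw [prodLaw_bind_right (PMF.uniformOfFintype (Fin n → ZMod q)) (iidPMF D m)]
    _ = realBlockLawInt bL q K m NV Kg J D α N num j := by
        rw [LWE.MP12.iidPMF_eq_indepLaw D m, LWE.MP12.iidPMF_eq_indepLaw D NV,
          BLPRS2013.indepLaw_bind_indepLaw m (fun _ => D) (fun _ => coarseKer bL q Kg J α N num j),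
          BLPRS2013.indepLaw_bind_indepLaw NV (fun _ => D) (fun _ => fineKer bL q K α N num),
          ← LWE.MP12.iidPMF_eq_indepLaw, ← LWE.MP12.iidPMF_eq_indepLaw]
        rfl

omit [InnerProductSpace ℝ E] [NeZero K] in
/-- **Fubini for the whole experiment, integer-noise form**: averaging `condExpK` over the first
`(K_g+1)·J·(m+N_V)` vectors of an iid batch `w ← D^{N_tot}`, regrouped into blocks, gives the experiment
with data `regevDataInt` and the kernel oracle. [folklore] -/
theorem iidPMF_bind_condExpK (D : PMF L) (α : ℝ) (N : ℕ) (num : L → ℤ) (A : Solver (Fin n) (ZMod q) m)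
    (Acc : (Fin n → ZMod q) → Set (Fin NV → (Fin n → ZMod q) × ZMod (q * K))) {Ntot : ℕ}
    (h : (Kg + 1) * J * (m + NV) ≤ Ntot) :
    ((iidPMF D Ntot).bind fun w => condExpK bL q K m NV Kg J α N num A Acc
        (blocksOf ((Kg + 1) * J) (m + NV) fun i => w (Fin.castLE h i))) =
      (indepLaw ((Kg + 1) * J) fun j =>
        (realBlockLawInt bL q K m NV Kg J D α N num j).bind (withAnswer q K m NV A)).map
        (firstAcceptedK q K m NV Acc) := by
  have hbatch : (iidPMF D Ntot).map (fun w => blocksOf ((Kg + 1) * J) (m + NV) fun i => w (Fin.castLE h i)) =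
      iidPMF (iidPMF D (m + NV)) ((Kg + 1) * J) := by
    rw [← iidPMF_map_blocksOf, ← LWE.MP12.iidPMF_map_comp_castLE D h, PMF.map_comp]
    rfl
  calc ((iidPMF D Ntot).bind fun w => condExpK bL q K m NV Kg J α N num A Acc
          (blocksOf ((Kg + 1) * J) (m + NV) fun i => w (Fin.castLE h i)))
      = ((iidPMF D Ntot).map fun w => blocksOf ((Kg + 1) * J) (m + NV) fun i => w (Fin.castLE h i)).bind
          (condExpK bL q K m NV Kg J α N num A Acc) := by
        rw [PMF.bind_map]; rfl
    _ = (iidPMF (iidPMF D (m + NV)) ((Kg + 1) * J)).bind (condExpK bL q K m NV Kg J α N num A Acc) := by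
        rw [hbatch]
    _ = ((iidPMF (iidPMF D (m + NV)) ((Kg + 1) * J)).bind fun w => indepLaw ((Kg + 1) * J) fun j =>
          (condBlockData bL q K m NV Kg J α N num j (w j)).bind (withAnswer q K m NV A)).map
          (firstAcceptedK q K m NV Acc) := by
        rw [PMF.map_bind]; rfl
    _ = _ := by
        rw [LWE.MP12.iidPMF_eq_indepLaw (iidPMF D (m + NV)) ((Kg + 1) * J),
          BLPRS2013.indepLaw_bind_indepLaw ((Kg + 1) * J) (fun _ => iidPMF D (m + NV))
            (fun j u => (condBlockData bL q K m NV Kg J α N num j u).bind (withAnswer q K m NV A))]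
        congr 1
        refine congrArg _ (funext fun j => ?_)
        show ((iidPMF D (m + NV)).bind fun u =>
            (condBlockData bL q K m NV Kg J α N num j u).bind (withAnswer q K m NV A)) = _
        rw [← PMF.bind_bind, iidPMF_bind_condBlockData]

/-- **Fubini for the whole experiment**: with `N` even and `N⟨x, v⟩ = num v ∈ ℤ` on `L`, averaging the
conditional experiment over the iid lattice batch `w ← D^{N_tot}` IS `regevBDDK`. [cite: RegevLWE2009, Lemma 3.4 (proof = §3.2.1); Peikert2009, Prop. 3.2] -/
theorem iidPMF_bind_condExpK_eq_regevBDDK (D : PMF L) (x : E) (α : ℝ) {N : ℕ} (hN : 2 ∣ N) (hN0 : 0 < N)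
    (num : L → ℤ) (hnum : ∀ v : L, (N : ℝ) * ⟪x, (v : E)⟫_ℝ = num v) (A : Solver (Fin n) (ZMod q) m)
    (Acc : (Fin n → ZMod q) → Set (Fin NV → (Fin n → ZMod q) × ZMod (q * K))) {Ntot : ℕ}
    (h : (Kg + 1) * J * (m + NV) ≤ Ntot) :
    ((iidPMF D Ntot).bind fun w => condExpK bL q K m NV Kg J α N num A Acc
        (blocksOf ((Kg + 1) * J) (m + NV) fun i => w (Fin.castLE h i))) =
      regevBDDK bL q K m NV Kg J D x α A Acc := by
  rw [iidPMF_bind_condExpK, regevBDDK]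
  congr 1
  refine congrArg _ (funext fun j => ?_)
  rw [realBlockLawK, realBlockLaw_eq_realBlockLawInt bL q K m NV Kg J D x α hN hN0 num hnum j]

end Conditional

/-! ### The dictionary of a nonsingular instance: denominators, numerators, secret and digit table -/

namespace DigitOracle

open Peikert2009 Literature.Algebra.EuclideanLattices.LatticeInstance

/-- LOCAL GLUE. **The common denominator** `N₀(t) = 2·∏_j den(t_j)` of the query coordinates (even,
positive): `N₀⟨x, v⟩ ∈ ℤ` for `x = Σ t_j b^∨_j` and every `v ∈ L(B)`. [cite: Regev2009, Lemma 3.11 (proof, Eq. (10)) — integer arithmetic form] -/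
def denom {k : ℕ} (t : Fin k → ℚ) : ℕ := 2 * ∏ j, (t j).den

/-- `N₀(t) > 0`. [folklore] -/
theorem denom_pos {k : ℕ} (t : Fin k → ℚ) : 0 < denom t :=
  Nat.mul_pos two_pos (Finset.prod_pos fun j _ => (t j).den_pos)

/-- `N₀(t)` is even. [folklore] -/
theorem two_dvd_denom {k : ℕ} (t : Fin k → ℚ) : 2 ∣ denom t := dvd_mul_right 2 _

/-- LOCAL GLUE. The integers `N₀(t)·t_j`. [folklore] -/
def scaled {k : ℕ} (t : Fin k → ℚ) (j : Fin k) : ℤ := 2 * (∏ i ∈ univ.erase j, ((t i).den : ℤ)) * (t j).num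

/-- `scaled t j = N₀(t)·t_j`. [folklore] -/
theorem cast_scaled {k : ℕ} (t : Fin k → ℚ) (j : Fin k) :
    (scaled t j : ℝ) = (denom t : ℝ) * ((t j : ℚ) : ℝ) := by
  have hden : ((t j).den : ℝ) ≠ 0 := Nat.cast_ne_zero.2 (t j).den_nz
  rw [scaled, denom, Nat.cast_mul, Nat.cast_prod,
    ← Finset.mul_prod_erase univ (fun i => ((t i).den : ℝ)) (mem_univ j), Rat.cast_def (t j)]
  push_cast
  field_simp

/-- LOCAL GLUE. **The integer `num v = N₀(t)⟨x, v⟩`** for `v ∈ L(B)`: `Σ_j (N₀ t_j)·(B-coordinate of v)_j`.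
[cite: Regev2009, Lemma 3.11 (proof, Eq. (10)) — integer arithmetic form] -/
def numZ (I : LatticeInstance) [IsZLattice ℝ I.lattice] (t : Fin I.n → ℚ) (v : I.lattice) : ℤ :=
  ∑ j, scaled t j * (zBasis I).repr v j

/-- `⟨Σ t_j b^∨_j, v⟩ = Σ t_j (B-coordinate of v)_j` (biorthogonality). [folklore] -/
theorem inner_point_coe (I : LatticeInstance) [IsZLattice ℝ I.lattice] (t : Fin I.n → ℚ) (v : I.lattice) :
    ⟪point I t, (v : EuclideanSpace ℝ (Fin I.n))⟫_ℝ = ∑ j, ((t j : ℚ) : ℝ) * ((zBasis I).repr v j : ℝ) := by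
  rw [point_eq, sum_inner]
  refine Finset.sum_congr rfl fun j _ => ?_
  rw [real_inner_smul_left, ← coe_dualZBasis, real_inner_comm,
    inner_coe_basis_eq_repr (zBasis I) (dualZBasis I) (inner_zBasis_dualZBasis I) v j]

/-- **`N₀(t)⟨x, v⟩ = num v`** on `L(B)` (hypothesis `hnum` of the integer-noise form). [folklore] -/
theorem denom_mul_inner_point (I : LatticeInstance) [IsZLattice ℝ I.lattice] (t : Fin I.n → ℚ) (v : I.lattice) :
    (denom t : ℝ) * ⟪point I t, (v : EuclideanSpace ℝ (Fin I.n))⟫_ℝ = numZ I t v := by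
  rw [inner_point_coe, numZ, Finset.mul_sum]
  push_cast
  refine Finset.sum_congr rfl fun j _ => ?_
  rw [cast_scaled]
  ring

/-- Biorthogonality, dual side first: `⟪b^∨ᵢ, bⱼ⟫ = δᵢⱼ`. [folklore] -/
theorem inner_dualZBasis_zBasis (I : LatticeInstance) [IsZLattice ℝ I.lattice] (i j : Fin I.n) :
    ⟪((dualZBasis I i : dualLattice I.lattice) : EuclideanSpace ℝ (Fin I.n)),
      ((zBasis I j : I.lattice) : EuclideanSpace ℝ (Fin I.n))⟫_ℝ = if i = j then 1 else 0 := by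
  rw [real_inner_comm, inner_zBasis_dualZBasis]
  simp only [@eq_comm _ j i]

/-- **The secret of the manufactured samples is `(B^∨)⁻¹κ mod q`**, the dual coordinates of the close
dual lattice point. [cite: Regev2009, Lemma 3.11 (proof: "s = (L*)⁻¹κ_{L*}(x) mod p")] -/
theorem secretOf_zBasis (I : LatticeInstance) [IsZLattice ℝ I.lattice] (q : ℕ) (κ : dualLattice I.lattice) :
    secretOf (zBasis I) q (κ : EuclideanSpace ℝ (Fin I.n)) = fun i => (((dualZBasis I).repr κ i : ℤ) : ZMod q) :=
  secretOf_eq_of_biorth (dualZBasis I) (zBasis I) q (inner_dualZBasis_zBasis I) κ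

/-- **The digit table is the table of the secret** when the query point is within `λ₁(L*)/2` of `κ ∈ L*`.
[cite: Regev2009, §3.2.1 (definition of CVP^{(p)}: "outputs L⁻¹κ_L(x) mod p")] -/
theorem answerTable_eq_table_secretOf (q : ℕ) (I : LatticeInstance) [IsZLattice ℝ I.lattice]
    (t : Fin I.n → ℚ) (κ : dualLattice I.lattice)
    (hκ : ‖point I t - κ‖ < minNorm (dualLattice I.lattice) / 2) :
    answerTable q I t = CVPOracle.table (Nat.size q) fun j =>
      (secretOf (zBasis I) q (κ : EuclideanSpace ℝ (Fin I.n)) j).val := by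
  rw [answerTable, secretOf_zBasis]
  congr 1
  funext j
  rw [digits, CVPOracle.coords_eq_repr I κ hκ]

/-- `ofReal (1 - Pr[E]) = Pr[Eᶜ]` for a `PMF`. [folklore] -/
theorem ofReal_one_sub_toReal_toOuterMeasure {β : Type} (p : PMF β) (S : Set β) :
    ENNReal.ofReal (1 - (p.toOuterMeasure S).toReal) = p.toOuterMeasure Sᶜ := by
  have hc : p.toOuterMeasure Sᶜ = 1 - p.toOuterMeasure S := by
    rw [← one_sub_toOuterMeasure_compl p Sᶜ, compl_compl]
  have hle : p.toOuterMeasure S ≤ 1 := pmf_toOuterMeasure_le_one p S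
  rw [hc, ← ENNReal.toReal_one, ← ENNReal.toReal_sub_of_le hle ENNReal.one_ne_top,
    ENNReal.ofReal_toReal (ENNReal.sub_ne_top ENNReal.one_ne_top)]

/-- **The failure probability of the machine on one query, in `ℝ≥0∞`**: the mass its output kernel puts
off the strings starting with the digit table. [folklore] -/
theorem ofReal_failProb (T : UniformQCircuitFamily) (q : ℕ) (I : LatticeInstance) (ρ : ℚ) (k : ℕ)
    (y : List Bool) (t : Fin I.n → ℚ) :
    ENNReal.ofReal (failProb T q I ρ k y t) =
      (T.kernel (query I ρ k y t)).toOuterMeasure {σ | answerTable q I t <+: σ}ᶜ := by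
  rw [failProb, UniformQCircuitFamily.kernelProb_eq]
  exact ofReal_one_sub_toReal_toOuterMeasure _ _

/-! ### The schedule and the conditional experiment of an instance -/

/-- LOCAL GLUE. Padding levels minus one, `K_g = 24m + 1` (`= Peikert2009.schedKg m n` at `m = m(n)`).
[cite: RegevLWE2009, Lemma 3.7 (proof)] -/
def nLevels (m : ℕ) : ℕ := 24 * m + 1

/-- LOCAL GLUE. Verification samples `N_V(n) = 2·schedNV(n) = 1600000(n+1)` (doubled w.r.t.
`PeikertBDDSchedule.lean` because the machine's RATIONAL cosine test has the error exponents `/64, /256`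
of `RegevCosApprox.lean` instead of `/32, /128`). [cite: RegevLWE2009, Lemma 3.6 (proof: "n samples")] -/
def nVerify (n : ℕ) : ℕ := 2 * schedNV n

/-- LOCAL GLUE. Lattice vectors consumed: `(K_g+1)·J·(m+N_V)`. [cite: RegevLWE2009, Lemma 3.4 (proof)] -/
def nVectors (m n : ℕ) : ℕ := (nLevels m + 1) * schedJ n * (m + nVerify n)

/-- LOCAL GLUE. **The machine's verification test** (Lemma 3.6 with the rational readout `cosReadout` and
threshold `thresholdReadout α` of `RegevCosApprox.lean`; everything it compares is rational).
[cite: RegevLWE2009, Lemma 3.6 (proof)] -/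
def accTest (q : ℕ) [NeZero q] {k : ℕ} (NV : ℕ) (α : ℝ) :
    (Fin k → ZMod q) → Set (Fin NV → (Fin k → ZMod q) × ZMod (q * schedK)) :=
  acceptSetStat q schedK (cosReadout (q * schedK)) NV (thresholdReadout α)

/-- LOCAL GLUE. **The conditional experiment of an instance**: `condExpK` on `L(I)` with the basis `B`
(`zBasis`), modulus `q`, fine factor `K = 512`, the schedule, the integer arithmetic `(N₀(t), num)`, the
kernel oracle `A`, the rational test, fed the first `nVectors m n` vectors of the batch `w` in blocks. This
is, exactly, the law the machine of A_cvpqM must realise from its coins and its calls to the oracle.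
[cite: Regev2009, Lemma 3.4 (proof = §3.2.1: Lemmas 3.6, 3.7, 3.11, 4.1)] -/
def condExp (q : ℕ) [NeZero q] (m : ℕ) (α : ℝ) (I : LatticeInstance) (hI : I.IsNonsingular)
    (A : Solver (Fin I.n) (ZMod q) m) (t : Fin I.n → ℚ) {P : ℕ} (w : Fin P → I.lattice)
    (hP : nVectors m I.n ≤ P) : PMF (Option (Fin I.n → ZMod q)) :=
  haveI := I.isZLattice_of_isNonsingular hI
  condExpK (zBasis I) q schedK m (nVerify I.n) (nLevels m) (schedJ I.n) α (denom t) (numZ I t) A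
    (accTest q (nVerify I.n) α)
    (blocksOf ((nLevels m + 1) * schedJ I.n) (m + nVerify I.n) fun i => w (Fin.castLE hP i))

end DigitOracle

end Regev2009

/-! ### The machine residual and the assembly -/

section Split

open _root_.Computability Literature.Computability.Complexity Literature.Computability.Complexity.CodeFP
  Literature.Computability.QuantumComplexity Literature.Algebra.EuclideanLattices Regev2009
  Regev2009.DigitOracle Peikert2009 LWE Literature.Probability.Distributions Literature.Probability.Moments

variable (q : ℕ → ℕ) [∀ n, NeZero (q n)] (α : ℕ → ℝ)

/-- NAMED FACT (residual A_cvpqM, the MACHINE half of A_cvpq) — **Regev 2009, Lemmas 3.11/3.7/3.6 and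
4.1: the reduction's program, with the `LWE` machine `W` substituted, realises the conditional
experiment.** Regev, Lemma 3.11 (p. 18, proof): "consider the distribution obtained by sampling a vector
`v` from `D_{L,r}`, and outputting `(L⁻¹v mod p, ⌊p⟨x, v⟩ + e⌉ mod p)` (10) … Since we can efficiently
sample from [it] using the given samples from `D_{L,r}`, we can apply `W` in order to find `s`"; Lemma 3.7
(p. 16, proof): "the set `Z` of all integer multiples of `n^{-2c}α²` between `0` and `α²` … estimate
the behavior of `W` on `m` samples … adding … a small amount of noise … using Lemma 3.6 … repeat";
Lemma 3.6 (verification by the empirical mean of `cos(2π·)`); Lemma 4.1 (random self-reduction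
`(a, b) ↦ (a, b + ⟨a, t⟩)`); and the substitution of the uniform quantum family `W` as a subroutine.
Machine form: for every uniform quantum polynomial-time family `W` (NO promise on `W` is needed — the
statement is about simulation, not success) there are a uniform family `T` and a negligible `ν` such that,
eventually in `n`, for every nonsingular instance `I` of dimension `n`, all `ρ, k`, every rational
coordinate vector `t`, every batch `w` of at least `nVectors (m n) n` lattice vectors (given in integer
coordinates, `encBatch ∘ intCoords`) and every candidate `c ∈ ℤ_qⁿ`: the probability that `T` on the query
string `DigitOracle.query I ρ k (encBatch …) t` does NOT write the table of `c` on its first wires is at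
most the probability that the CONDITIONAL EXPERIMENT `DigitOracle.condExp` (all randomness except the
batch: uniform shifts, integer Gaussians `floorGaussian`, the calls to `W.searchLWESolver`; explicit
integer arithmetic; the rational cosine test) does not output `c`, plus `ν(n)`. Its content is
programming only: fixed-point arithmetic, coin samplers for `floorGaussian (q·N₀) σ` and for the uniform
shift within negligible statistical distance (widths `σ² ∈ ℚ·α²`, not the `π·ℚ` widths served by the
tree's `rejLaw`/`PGParams` samplers), and the composition of uniform families with the quantum family `W`
(BBBV, Thm. 4.14). ALL the probability/lattice mathematics of Lemmas 3.6, 3.7, 3.11 and 4.1 is proved in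
the tree (`regev2009_lemma_3_11_cvpqFamily_of_machine` below). Users take `(hM : regev2009_lemma_3_11_cvpqMachine q α)`.
[cite: Regev2009, Lemma 3.11 (p. 18), Lemma 3.7 (p. 16), Lemma 3.6 (p. 16), Lemma 4.1 (p. 23); BennettBernsteinBrassardVazirani1997, Thm. 4.14] -/
def regev2009_lemma_3_11_cvpqMachine : Prop :=
  ∀ (m : ℕ → ℕ) (_ : IsPolyBounded m) (_ : IsPolyTimeParams q α m)
    (a : ℕ → ℚ), (∀ n, α n = a n) → PolyTimeComputable unaryEncodeNat encodeRat a →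
    ∀ W : UniformQCircuitFamily,
      ∃ (T : UniformQCircuitFamily) (ν : ℕ → ℝ), IsNegligible ν ∧
        ∀ᶠ n : ℕ in atTop, ∀ (I : LatticeInstance) (hI : I.IsNonsingular) (ρ : ℚ) (k : ℕ) (t : Fin I.n → ℚ)
          (P : ℕ) (w : Fin P → I.lattice) (hP : nVectors (m I.n) I.n ≤ P) (c : Fin I.n → ZMod (q I.n)),
          I.n = n →
          (T.kernel (query I ρ k (encBatch I.n P fun i => I.intCoords (w i)) t)).toOuterMeasure
              {σ | CVPOracle.table (Nat.size (q I.n)) (fun j => (c j).val) <+: σ}ᶜ ≤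
            (condExp (q I.n) (m I.n) (α I.n) I hI (W.searchLWESolver I.n (q I.n) (m I.n)) t w hP).toOuterMeasure
                {o | o ≠ some c} + ENNReal.ofReal (ν n)

/-- `2^{-cn} ≤ 1/3` eventually (`c > 0`). [folklore] -/
theorem eventually_two_rpow_neg_le_third {c : ℝ} (hc : 0 < c) :
    ∀ᶠ n : ℕ in atTop, (2 : ℝ) ^ (-(c * n)) ≤ 1 / 3 := by
  filter_upwards [eventually_ge_atTop (Nat.ceil (2 / c))] with n hn
  have hn' : 2 / c ≤ (n : ℝ) := (Nat.le_ceil _).trans (by exact_mod_cast hn)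
  have hcn : 2 ≤ c * n := by
    rw [div_le_iff₀ hc] at hn'
    linarith [mul_comm c (n : ℝ)]
  calc (2 : ℝ) ^ (-(c * n)) ≤ (2 : ℝ) ^ (-(2 : ℝ)) :=
        Real.rpow_le_rpow_of_exponent_le one_le_two (by linarith)
    _ = 1 / 4 := by
        rw [Real.rpow_neg zero_le_two, Real.rpow_two]
        norm_num
    _ ≤ 1 / 3 := by norm_num

/-- **Worst-case success `≥ 1 - δ` for every secret gives average-case success `≥ 1 - δ`.** [folklore] -/
theorem le_searchSuccessProb_of_forall {n qv m : ℕ} [NeZero qv] (χ : PMF (ZMod qv))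
    (A : Solver (Fin n) (ZMod qv) m)
    {x : ENNReal} (h : ∀ s, x ≤ searchSuccessProbOf χ m A s) : x ≤ searchSuccessProb χ m A := by
  unfold searchSuccessProb
  have h1 := PMF.tsum_coe (PMF.uniformOfFintype (Fin n → ZMod qv))
  rw [tsum_fintype] at h1
  calc x = ∑ s : Fin n → ZMod qv, PMF.uniformOfFintype (Fin n → ZMod qv) s * x := by
        rw [← Finset.sum_mul, h1, one_mul]
    _ ≤ _ := Finset.sum_le_sum fun s _ => mul_le_mul' le_rfl (h s)

/-- **A_cvpq from A_cvpqM: the LAW half of Regev's Lemmas 3.11/3.7/3.6/4.1 is a theorem.** Given the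
machine residual, the `CVP^{(q)}` family of A_cvpq (`regev2009_lemma_3_11_cvpqFamily`) follows, with the
batch polynomial `p_N(n) = (24 p_m(n) + 2)(n + 1)(p_m(n) + 1600000(n + 1))` and the negligible bound
`Peikert2009.failureBound m N_V (6ε) (2⁻ⁿ) + |ν|`: per query, the batch-averaged failure of `T` is (A_cvpqM)
at most the failure of the conditional experiment averaged over the batch `D_{L(I),ρ}^{p_N}` plus `ν`; by
Fubini (`iidPMF_bind_condExpK_eq_regevBDDK`, with `N₀(t)⟨x,v⟩ = num v ∈ ℤ`) that average IS the idealised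
kernel experiment `regevBDDK`, whose failure to output the secret `(B^∨)⁻¹κ mod q` — whose table IS the digit
table (`answerTable_eq_table_secretOf`, `decodingDist_lt_half_minNorm_dual`) — is bounded by
`toReal_regevBDDK_ne_le_readout` (Lemmas 3.6, 3.7, 3.11, 4.1 proved) under Regev's regime
(`0 < α < 1`, `2√n < αq`, `ρ > √2 q η_ε(L)`, `ε ≤ e^{-π}` eventually) and the worst-case promise on `W`
(`≥ 1 - 2^{-cn} ≥ 2/3` for every secret, hence on average).
[cite: Regev2009, Lemma 3.11 (p. 18) with Lemmas 3.6, 3.7 (p. 16), Lemma 4.1 (p. 23) and Claim 2.13; Peikert2009, Prop. 3.2] -/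
theorem regev2009_lemma_3_11_cvpqFamily_of_machine (hM : regev2009_lemma_3_11_cvpqMachine q α) :
    regev2009_lemma_3_11_cvpqFamily q α := by
  intro m hm hP hreg hW ε hε hεpos a hαa hac
  obtain ⟨W, cW, hcW, hWsolves⟩ := hW
  obtain ⟨T, ν, hν, hTn⟩ := hM m hm hP a hαa hac W
  obtain ⟨pm, hpm⟩ := hm
  -- the batch polynomial
  set pN : Polynomial ℕ := (24 * pm + 2) * (Polynomial.X + 1) * (pm + 1600000 * (Polynomial.X + 1)) with hpNdef
  have hpN_eval : ∀ n, pN.eval n = (24 * pm.eval n + 2) * (n + 1) * (pm.eval n + 1600000 * (n + 1)) := fun n => by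
    simp [hpNdef]
  have hpN_pos : ∀ n, 0 < pN.eval n := fun n => by rw [hpN_eval]; positivity
  have hvec : ∀ n, nVectors (m n) n ≤ pN.eval n := fun n => by
    rw [hpN_eval, nVectors, nLevels, nVerify, schedJ, schedNV]
    have h1 : 24 * m n + 1 + 1 ≤ 24 * pm.eval n + 2 := by linarith [hpm n]
    have h2 : m n + 2 * (800000 * (n + 1)) ≤ pm.eval n + 1600000 * (n + 1) := by linarith [hpm n]
    exact Nat.mul_le_mul (Nat.mul_le_mul_right _ h1) h2
  -- the negligible bound
  have hNVpb : IsPolyBounded nVerify := ⟨1600000 * (Polynomial.X + 1), fun n => by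
    simp [nVerify, schedNV]; omega⟩
  have h6ε : IsNegligible fun n => 6 * ε n := by
    simpa using hε.polynomial_mul (Polynomial.C (6 : ℝ))
  have hfb : IsNegligible (failureBound m nVerify (fun n => 6 * ε n) fun n => (2⁻¹ : ℝ) ^ n) :=
    isNegligible_failureBound ⟨pm, hpm⟩ hNVpb h6ε (fun n => by linarith [hεpos n]) isNegligible_two_inv_pow
      (fun n => by positivity)
  have hνa : IsNegligible fun n => |ν n| :=
    Asymptotics.SuperpolynomialDecay.trans_abs_le hν fun n => by rw [abs_abs]
  -- eventual side conditions
  have hεπ : ∀ᶠ n : ℕ in atTop, ε n ≤ Real.exp (-Real.pi) := by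
    have h0 := hε 0
    simp only [pow_zero, one_mul] at h0
    exact (h0.eventually (ge_mem_nhds (Real.exp_pos _))).mono fun n hn => hn
  have hεh : ∀ᶠ n : ℕ in atTop, ε n ≤ 1 / 2 := by
    have h0 := hε 0
    simp only [pow_zero, one_mul] at h0
    exact (h0.eventually (ge_mem_nhds (by norm_num : (0:ℝ) < 1 / 2))).mono fun n hn => hn
  refine ⟨T, pN, fun n => failureBound m nVerify (fun n => 6 * ε n) (fun n => (2⁻¹ : ℝ) ^ n) n + |ν n|,
    hfb.add hνa, hpN_pos, ?_⟩
  filter_upwards [hTn, hWsolves, hreg, hεπ, hεh, eventually_two_rpow_neg_le_third hcW, eventually_gt_atTop 0]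
    with n hTn' hWn hregn hεn hεhn h3 hn0 I ρ hIn hI hsm k t ht
  obtain ⟨hα0, hα1, hαq⟩ := hregn
  subst hIn
  haveI := I.isZLattice_of_isNonsingular hI
  have hq0 : (0 : ℝ) < q I.n := by exact_mod_cast Nat.pos_of_ne_zero (NeZero.ne (q I.n))
  have hq2 : 2 ≤ q I.n := two_le_of_regime hn0 hα1 hαq
  have hαabs : |α I.n| ≤ 1 := by rw [abs_of_pos hα0]; exact hα1.le
  -- the close dual point and the secret
  have hd : α I.n * q I.n / (Real.sqrt 2 * ρ) < minNorm (dualLattice I.lattice) / 2 :=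
    decodingDist_lt_half_minNorm_dual I hI hn0 (hεpos _) hεn hα0 hα1 hq0 hsm
  obtain ⟨κ, hκ, hxκ⟩ := ht
  have hlt : ‖point I t - κ‖ < minNorm (dualLattice I.lattice) / 2 := hxκ.trans_lt hd
  set s : Fin I.n → ZMod (q I.n) := secretOf (zBasis I) (q I.n) κ with hs
  have htable : answerTable (q I.n) I t = CVPOracle.table (Nat.size (q I.n)) fun j => (s j).val :=
    answerTable_eq_table_secretOf (q I.n) I t ⟨κ, hκ⟩ hlt
  -- `ρ > 0` and Regev's distance hypothesis `ρ‖x - κ‖ ≤ (α/√2)q`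
  have hρ0 : (0 : ℝ) < ρ := lt_of_le_of_lt
    (mul_nonneg (by positivity) (smoothingParameter_nonneg I.lattice (ε I.n))) hsm
  have hx : (ρ : ℝ) * ‖point I t - κ‖ ≤ α I.n / Real.sqrt 2 * q I.n := by
    calc (ρ : ℝ) * ‖point I t - κ‖ ≤ ρ * (α I.n * q I.n / (Real.sqrt 2 * ρ)) :=
          mul_le_mul_of_nonneg_left hxκ hρ0.le
      _ = α I.n / Real.sqrt 2 * q I.n := by
          field_simp
  -- the oracle: worst case `≥ 1 - 2^{-cn} ≥ 2/3`, hence on average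
  set A : Solver (Fin I.n) (ZMod (q I.n)) (m I.n) := W.searchLWESolver I.n (q I.n) (m I.n) with hA
  have hF : ENNReal.ofReal (2 / 3) ≤ searchSuccessProb (discretizedGaussian (q I.n) (α I.n)) (m I.n) A :=
    le_searchSuccessProb_of_forall _ A fun s' =>
      (ENNReal.ofReal_le_ofReal (by linarith [h3])).trans (hWn s')
  -- the verification schedule
  have hqK : 4 * π * Real.exp (π * α I.n ^ 2) ≤ (q I.n * schedK : ℕ) := hqK_sched hq2 hαabs
  have hNV : Real.exp (-(nVerify I.n * Real.exp (-(2 * π * α I.n ^ 2)) / 256)) ≤ 1 / 7 := by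
    have h : (nVerify I.n : ℝ) * Real.exp (-(2 * π * α I.n ^ 2)) / 256 =
        schedNV I.n * Real.exp (-(2 * π * α I.n ^ 2)) / 128 := by
      rw [nVerify]; push_cast; ring
    rw [h]
    exact hNV_sched I.n hαabs
  have hηA : Real.exp (-(nVerify I.n * Real.exp (-(2 * π * α I.n ^ 2)) / 64)) ≤ (2⁻¹ : ℝ) ^ I.n := by
    have h : (nVerify I.n : ℝ) * Real.exp (-(2 * π * α I.n ^ 2)) / 64 =
        schedNV I.n * Real.exp (-(2 * π * α I.n ^ 2)) / 32 := by
      rw [nVerify]; push_cast; ring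
    rw [h]
    exact exp_schedNV_le_two_inv_pow I.n hαabs
  -- the LAW: Lemmas 3.6/3.7/3.11/4.1 proved
  set D : PMF I.lattice := discreteGaussian I.lattice ρ 0 with hD
  have hlaw := toReal_regevBDDK_ne_le_readout (zBasis I) (q I.n) schedK (m I.n) (nVerify I.n)
    (nLevels (m I.n)) (schedJ I.n) D (δ := 0) (by rw [hD, PMF.tvDist_self]) (hεpos I.n) hεhn hρ0 hα0 hα1.le
    hsm.le (point I t) hκ hx A hF (by unfold nLevels; omega) (by unfold nLevels; omega) hqK hNV
  obtain ⟨B, hBle, hlaw'⟩ : ∃ B : ℝ, B ≤ failureBound m nVerify (fun n => 6 * ε n) (fun n => (2⁻¹ : ℝ) ^ n) I.n ∧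
      ((regevBDDK (zBasis I) (q I.n) schedK (m I.n) (nVerify I.n) (nLevels (m I.n)) (schedJ I.n) D (point I t)
        (α I.n) A (accTest (q I.n) (nVerify I.n) (α I.n))).toOuterMeasure {o | o ≠ some s}).toReal ≤ B := by
    refine ⟨_, ?_, hlaw⟩
    rw [failureBound]
    have hnB : (0 : ℝ) ≤ ((nLevels (m I.n) + 1) * schedJ I.n : ℕ) := Nat.cast_nonneg _
    have hmN : (0 : ℝ) ≤ (m I.n : ℝ) + (nVerify I.n : ℝ) := add_nonneg (Nat.cast_nonneg _) (Nat.cast_nonneg _)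
    have h6 : (0 : ℝ) ≤ 6 * (2⁻¹ : ℝ) ^ I.n := mul_nonneg (by norm_num) (pow_nonneg (by norm_num) _)
    have hε0 := hεpos I.n
    exact add_le_add (mul_le_mul_of_nonneg_left (mul_le_mul_of_nonneg_left (by linarith) hmN) hnB)
      (add_le_add (mul_le_mul_of_nonneg_left hηA hnB) le_rfl)
  have hB0 : 0 ≤ B := ENNReal.toReal_nonneg.trans hlaw'
  -- Fubini: the conditional experiment averaged over the batch IS `regevBDDK`
  have hfub : ((iidPMF D (pN.eval I.n)).bind fun w =>
      condExp (q I.n) (m I.n) (α I.n) I hI A t w (hvec I.n)) =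
      regevBDDK (zBasis I) (q I.n) schedK (m I.n) (nVerify I.n) (nLevels (m I.n)) (schedJ I.n) D (point I t)
        (α I.n) A (accTest (q I.n) (nVerify I.n) (α I.n)) :=
    iidPMF_bind_condExpK_eq_regevBDDK (zBasis I) (q I.n) schedK (m I.n) (nVerify I.n) (nLevels (m I.n))
      (schedJ I.n) D (point I t) (α I.n) (two_dvd_denom t) (denom_pos t) (numZ I t)
      (denom_mul_inner_point I t) A _ (hvec I.n)
  -- the batch average as a bind, and the pointwise machine bound
  simp_rw [ofReal_failProb, htable]
  rw [idealBatchZ_eq_map, ← PMF.toOuterMeasure_bind_apply, PMF.bind_map, PMF.toOuterMeasure_bind_apply]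
  calc ∑' w, (iidPMF D (pN.eval I.n)) w *
        (T.kernel (query I ρ k (encBatch I.n (pN.eval I.n) ((fun w => I.intCoords ∘ w) w)) t)).toOuterMeasure
          {σ | CVPOracle.table (Nat.size (q I.n)) (fun j => (s j).val) <+: σ}ᶜ
      ≤ ∑' w, (iidPMF D (pN.eval I.n)) w *
          ((condExp (q I.n) (m I.n) (α I.n) I hI A t w (hvec I.n)).toOuterMeasure {o | o ≠ some s} +
            ENNReal.ofReal |ν I.n|) :=
        ENNReal.tsum_le_tsum fun w => mul_le_mul' le_rfl
          ((hTn' I hI ρ k t _ w (hvec I.n) s rfl).trans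
            (add_le_add le_rfl (ENNReal.ofReal_le_ofReal (le_abs_self _))))
    _ = ((iidPMF D (pN.eval I.n)).bind fun w =>
          condExp (q I.n) (m I.n) (α I.n) I hI A t w (hvec I.n)).toOuterMeasure {o | o ≠ some s} +
          ENNReal.ofReal |ν I.n| := by
        simp_rw [mul_add]
        rw [ENNReal.tsum_add, ENNReal.tsum_mul_right, PMF.tsum_coe, one_mul, PMF.toOuterMeasure_bind_apply]
    _ ≤ ENNReal.ofReal B + ENNReal.ofReal |ν I.n| := by
        rw [hfub]
        exact add_le_add ((ENNReal.le_ofReal_iff_toReal_le (pmf_toOuterMeasure_ne_top _ _) hB0).2 hlaw') le_rfl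
    _ = ENNReal.ofReal (B + |ν I.n|) := (ENNReal.ofReal_add hB0 (abs_nonneg _)).symm
    _ ≤ _ := ENNReal.ofReal_le_ofReal (add_le_add hBle le_rfl)

/-- **`pqc.S19` as filed — Regev's Theorem 1.1, `SIVP` form — from A_cvpqM (the machine of Lemmas
3.11/3.7/3.6/4.1 around the `LWE` oracle) and A_q14 (Lemma 3.14, quantum) alone**; A_lift is proved
(`RegevReductionCVPLiftFinish.lean`) and the law half of A_cvpq is proved here.
[cite: Regev2009, Theorem 1.1, Theorem 3.1, Lemma 3.3, Lemma 3.4, Lemmas 3.5–3.7, 3.11, 3.14, 3.17, 4.1] -/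
theorem regev_lwe_to_sivp_quantum_holds_of_machine_of_step (m : ℕ → ℕ)
    (hM : regev2009_lemma_3_11_cvpqMachine q α) (hQ : regev2009_lemma_3_14_stepFamily q α) :
    regev_lwe_to_sivp_quantum q α m :=
  regev_lwe_to_sivp_quantum_holds_of_cvpq_of_step q α m (regev2009_lemma_3_11_cvpqFamily_of_machine q α hM) hQ

/-- **Regev's Theorem 1.1, `GapSVP` form, from A_cvpqM and A_q14 alone.**
[cite: Regev2009, Theorem 1.1, Theorem 3.1, Lemma 3.3, Lemma 3.4, Lemmas 3.5–3.7, 3.11, 3.14, 3.20, 4.1] -/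
theorem regev_lwe_to_gapSVP_quantum_holds_of_machine_of_step (m : ℕ → ℕ)
    (hM : regev2009_lemma_3_11_cvpqMachine q α) (hQ : regev2009_lemma_3_14_stepFamily q α) :
    regev_lwe_to_gapSVP_quantum q α m :=
  regev_lwe_to_gapSVP_quantum_holds_of_cvpq_of_step q α m (regev2009_lemma_3_11_cvpqFamily_of_machine q α hM) hQ

end Split

end Literature.Computability.Cryptography

end

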